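import Summits.ResolutionOfSingularities.ResolutionOfSingularities.Theorems.PurelyInseparableDim4ResConeWeightsGeneric
import Summits.ResolutionOfSingularities.ResolutionOfSingularities.Theorems.PurelyInseparableDim4ResConeLossFreeTail
import Summits.ResolutionOfSingularities.ResolutionOfSingularities.Theorems.PurelyInseparableDim4ResConeKeepBudget
import HarnessLib
import HarnessLib.Audit.Tags

/-!
# Purely inseparable four-folds — THE KERNEL WEIGHT LEDGER of a constant-shade tail, EVERY prime `p` and EVERY shade `d`:
# the finite legal ledger on `Fin 4 → ℕ` (decidable, kernel-reducible), its SOUNDNESS over the chain, the three fairness laws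
# (DOCK / FT / C13) in ledger words, and the POTENTIAL SOCKET for `decide`-checked SCC certificates
# (cell `res-dim4-pi`, K2(p) lane, rung-1 generic brick; seat res-dim4-p-8 g6)

[OURS · counted 0 · cell `res-dim4-pi` · K2(p) lane (holder res-dim4-p-12 g5, rule (R-ii); SCOPING v1.1 §2/§2a, RUNG-0 EXIT TABLE v0) ·
seat res-dim4-p-8 g6.]  **HONEST LABEL.**  BOOKKEEPING about OUR MODEL (the point-blow-up walk `Step0 p` with cleaning on presented states
`(F, r, exc)` of `z^p + F(x₁..x₄)`, ISOLATED regime).  Nothing here proves any TAIL(p, d, e), K2(p) = `RidgeBudget.NoAboveFloorTrap p p`,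
`NoIsolatedTrap p p`, CJS Key Theorem 6.40 or resolution of singularities in dimension ≥ 4 / characteristic `p` — NOT proved.  AI kernel work.

THE POINT.  The K2(p) lane's «weight-ledger census» (holder's `wledger*.py`, K-twinned by three codes; 49 recurrent classes / 17
SCC-orbits on the binary-cone side at `p = 7`) is a HYPOTHESIS-FORMING Python datum: the finite directed graph on the legal boundary-weight
vectors `r : Fin 4 → ℕ` of a constant-shade-`d` tail, edges = the boundary law «chart `j`, any set of kept letters, newborn weight
`|r| + d − p`».  This file puts that graph IN THE KERNEL, once for every `(p, d)`:
* §1 THE FINITE LEDGER (pure numerics on `Fin 4 → ℕ`, `abbrev`s so that `decide` evaluates them): `WeightLedger.wsum` (`= r.degree`),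
  `WeightLedger.Legal p d a` (floor `p < |a| + d`, sharp ceiling `|a| + d + 2 ≤ 2p`, pair laws `≤ p − 2`, triple laws `≤ p − 1`),
  `WeightLedger.child p d a j S` (`S : Fin 4 → Bool` the kept flags), `WeightLedger.Lossy a b`, `WeightLedger.LowerBand p d a`
  (`|a| + d < 3p/2`); `legal_iff_explicit` (twelve clauses, fastest under `decide`), `Legal.apply_le`, and the binder-reduction helpers
  `forall_legal_of_forall_fin4` / `forall_flags_of_forall_bool4` («∀ legal `a`» from «∀ `a0 a1 a2 a3 : Fin (p − 1)`»).
* §2 SOUNDNESS (chain dress over res-dim4-p-9 g5's `tail_weights_laws`, res-dim4-p-3 g5's `shadeWeights_ceiling`, res-dim4-p-5's triple law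
  `IsolatedBand.apply_add_add_le_of_isIsolated`): **`tail_ledger_legal`**, **`tail_ledger_child`**, `tail_lossy_iff` (a boundary letter is
  translated at step `k` iff `Lossy r_k r_{k+1}`), `tail_isSatellite_iff` (`IsSatellite j b k ↔ j (k+1) ≠ j k ∧ r_{k+2} (j k) ≠ 0`).
* §3 THE THREE FAIRNESS LAWS IN LEDGER WORDS («beyond every index»): `exists_lowerBand_after` (the DOCK, `no_tail_of_lower_band_budget`
  with budget `0`), `exists_satellite_after` (FT, `no_tail_of_eventually_free`), `exists_lossy_after` (C13, `no_lossfree_tail`; `d < p`, `e_G ≡ 2`).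
* §4 POTENTIALS — THE CERTIFICATE SOCKET: for ANY `h : (Fin 4 → ℕ) → ℕ` non-increasing along legal ledger edges,
  **`ledger_potential_eventually_constant`** (the tail is CONFINED to one level set of `h`) and the three PRUNES
  **`no_tail_of_level_off_lowerBand`** / **`no_tail_of_level_satelliteFree`** / **`no_tail_of_level_lossfree`** (a level with no lower-band
  legal state / no legal satellite 2-path / (`e_G ≡ 2`, `d < p`) no lossy legal edge carries no tail) — hypotheses are finite `∀` over legal
  states, charts and kept flags: ONE `decide` each once `h` is a concrete table (rung 2; with `h` the reverse-topological SCC index the level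
  sets are the SCC-orbits, the «DEAD (ledger level)» rows of the RUNG-0 exit table become kernel corollaries, and the surviving rows receive the
  class binder «`∀ k ≥ k₁, Legal p d r_k ∧ h r_k = i`» by name).
NOT here: any geometry (TT, (I2), `e_G` transport), any `(7, ·)` instance (WORD #193 (δ)), any light-class theorem.
[cite: CossartJannsenSaito2020, Thm. 3.14, Lemma 13.2] [cite: HauserPerlega2019PRIMS, §2 (transform D′ of D)]
bears_on: LADDER-RESOLUTION:D157-DOOR2 (res-dim4-pi · K2(p) · kernel weight ledger, every prime, every shade).
Supports stmt-ResolutionOfSingularities-16155 (helper).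
-/

set_option linter.dupNamespace false -- mandated namespace of this single-conjunct summit

noncomputable section

namespace Summit.ResolutionOfSingularities.ResolutionOfSingularities.Theorems.PIDim4

namespace ResCone

open MvPolynomial Finset Literature.AlgebraicGeometry.Resolution
open Literature.AlgebraicGeometry.Resolution.CentreBlowup Literature.AlgebraicGeometry.Resolution.Hauser2010

/-! ## 1. The finite weight ledger of `(p, d)` — pure numerics on `Fin 4 → ℕ` -/

namespace WeightLedger

/-- The total boundary weight `|a| = a₀ + a₁ + a₂ + a₃` of a weight vector (`= r.degree`, `wsum_coe`). [folklore] -/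
abbrev wsum (a : Fin 4 → ℕ) : ℕ := a 0 + a 1 + a 2 + a 3
/-- `|⇑r| = r.degree` for a finitely supported weight vector on four letters. [folklore] -/
theorem wsum_coe (r : Fin 4 →₀ ℕ) : wsum ⇑r = r.degree := by rw [Finsupp.degree_eq_sum, Fin.sum_univ_four]

/-- **A LEGAL ledger state at `(p, d)`**: the floor `p < |a| + d` (above the floor, order `> p`), the sharp ceiling
`|a| + d + 2 ≤ 2p` (order `≤ 2p − 2`), the isolation PAIR laws `a_i + a_{i′} ≤ p − 2` and TRIPLE laws `a_i + a_{i′} + a_{i″} ≤ p − 1`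
— exactly the per-state constraints the chain supplies on a constant-shade-`d` tail (`tail_ledger_legal`).  An `abbrev`, hence
decidable by unfolding; a bookkeeping predicate of OUR frame, not a cited statement. [OURS · bookkeeping] -/
abbrev Legal (p d : ℕ) (a : Fin 4 → ℕ) : Prop :=
  p < wsum a + d ∧ wsum a + d + 2 ≤ 2 * p ∧
  (∀ i i' : Fin 4, i ≠ i' → a i + a i' ≤ p - 2) ∧
  (∀ i i' i'' : Fin 4, i ≠ i' → i ≠ i'' → i' ≠ i'' → a i + a i' + a i'' ≤ p - 1)

/-- **The ledger CHILD** of `a` by the chart `j` keeping the letters flagged by `S` (`S i = true` ⇔ letter `i` is not translated):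
the newborn letter `j` weighs `|a| + d − p`, a kept letter keeps its weight, a lost letter weighs `0` — the boundary law
`r_{k+1} = (r_k|_{b_k = 0}).update (j k) (|r_k| + d − p)` read on `Fin 4 → ℕ` (`tail_ledger_child`). [OURS · bookkeeping] -/
def child (p d : ℕ) (a : Fin 4 → ℕ) (j : Fin 4) (S : Fin 4 → Bool) : Fin 4 → ℕ :=
  fun i => if i = j then wsum a + d - p else if S i then a i else 0

/-- **A LOSSY edge**: some boundary letter of `a` (weight `≥ 1`) weighs `0` in `b` — on the chain, a boundary letter was translated
(`tail_lossy_iff`). [OURS · bookkeeping] -/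
abbrev Lossy (a b : Fin 4 → ℕ) : Prop := ∃ i : Fin 4, 1 ≤ a i ∧ b i = 0
/-- **A LOWER-BAND state**: `|a| + d < 3p/2` (natural-number division), the states res-dim4-p-3 g5's visit dock
`no_tail_of_lower_band_budget` forces a tail to visit beyond every index. [OURS · bookkeeping] -/
abbrev LowerBand (p d : ℕ) (a : Fin 4 → ℕ) : Prop := wsum a + d < 3 * p / 2

variable {p d : ℕ}

/-- The newborn letter of a child weighs `|a| + d − p`. [folklore] -/
theorem child_apply_self (a : Fin 4 → ℕ) (j : Fin 4) (S : Fin 4 → Bool) : child p d a j S j = wsum a + d - p := by simp [child]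

/-- A non-chart letter of a child keeps its weight if flagged kept and weighs `0` otherwise. [folklore] -/
theorem child_apply_of_ne (a : Fin 4 → ℕ) {j i : Fin 4} (h : i ≠ j) (S : Fin 4 → Bool) :
    child p d a j S i = if S i then a i else 0 := by simp [child, h]

/-- A non-chart letter of a child by PROPOSITIONAL kept flags (`S i = decide (P i)`; on the chain `P i :↔ b k i = 0`). [folklore] -/
theorem child_apply_of_ne_decide (a : Fin 4 → ℕ) {j i : Fin 4} (h : i ≠ j) (P : Fin 4 → Prop) [DecidablePred P] :
    child p d a j (fun i => decide (P i)) i = if P i then a i else 0 := by simp [child, h]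

/-- Every weight of a legal state is `≤ p − 2` (pair law with any other letter). [folklore] -/
theorem Legal.apply_le {a : Fin 4 → ℕ} (h : Legal p d a) (i : Fin 4) : a i ≤ p - 2 := by
  obtain ⟨-, -, hpair, -⟩ := h
  obtain ⟨i', hi'⟩ : ∃ i' : Fin 4, i ≠ i' := ⟨i + 1, fun h => by simpa using congrArg (fun x => x - i) h⟩
  have := hpair i i' hi'
  omega

/-- **The twelve-clause form of legality** (the six pairs and four triples written out) — the form under which `decide` is fastest.
[folklore] -/
theorem legal_iff_explicit (a : Fin 4 → ℕ) : Legal p d a ↔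
    (p < wsum a + d ∧ wsum a + d + 2 ≤ 2 * p ∧
    (a 0 + a 1 ≤ p - 2 ∧ a 0 + a 2 ≤ p - 2 ∧ a 0 + a 3 ≤ p - 2 ∧ a 1 + a 2 ≤ p - 2 ∧ a 1 + a 3 ≤ p - 2 ∧ a 2 + a 3 ≤ p - 2) ∧
    (a 0 + a 1 + a 2 ≤ p - 1 ∧ a 0 + a 1 + a 3 ≤ p - 1 ∧ a 0 + a 2 + a 3 ≤ p - 1 ∧ a 1 + a 2 + a 3 ≤ p - 1)) := by
  constructor
  · rintro ⟨h1, h2, hP, hT⟩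
    exact ⟨h1, h2, ⟨hP 0 1 (by decide), hP 0 2 (by decide), hP 0 3 (by decide), hP 1 2 (by decide), hP 1 3 (by decide),
      hP 2 3 (by decide)⟩, ⟨hT 0 1 2 (by decide) (by decide) (by decide), hT 0 1 3 (by decide) (by decide) (by decide),
      hT 0 2 3 (by decide) (by decide) (by decide), hT 1 2 3 (by decide) (by decide) (by decide)⟩⟩
  · rintro ⟨h1, h2, ⟨h01, h02, h03, h12, h13, h23⟩, ⟨h012, h013, h023, h123⟩⟩
    refine ⟨h1, h2, fun i i' hii' => ?_, fun i i' i'' hn1 hn2 hn3 => ?_⟩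
    · fin_cases i <;> fin_cases i' <;> simp at hii' ⊢ <;> omega
    · fin_cases i <;> fin_cases i' <;> fin_cases i'' <;> simp at hn1 hn2 hn3 ⊢ <;> omega

/-- **Binder reduction for `decide`, states**: a property of all LEGAL states follows from its instances at the vectors
`![a0, a1, a2, a3]` with `aᵢ : Fin (p − 1)` (every legal weight is `≤ p − 2`). [folklore] -/
theorem forall_legal_of_forall_fin4 {P : (Fin 4 → ℕ) → Prop}
    (H : ∀ a0 a1 a2 a3 : Fin (p - 1), P ![(a0 : ℕ), a1, a2, a3]) : ∀ a, Legal p d a → P a := by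
  intro a ha
  have h3 : 3 ≤ p := by obtain ⟨h1, h2, -, -⟩ := ha; omega
  have hlt : ∀ i, a i < p - 1 := fun i => by have := ha.apply_le i; omega
  have h := H ⟨a 0, hlt 0⟩ ⟨a 1, hlt 1⟩ ⟨a 2, hlt 2⟩ ⟨a 3, hlt 3⟩
  have heq : (![(a 0 : ℕ), a 1, a 2, a 3] : Fin 4 → ℕ) = a := by ext i; fin_cases i <;> rfl
  rwa [heq] at h

/-- **Binder reduction for `decide`, kept flags**: a property of all flag vectors follows from its instances at `![s0, s1, s2, s3]`.
[folklore] -/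
theorem forall_flags_of_forall_bool4 {P : (Fin 4 → Bool) → Prop} (H : ∀ s0 s1 s2 s3 : Bool, P ![s0, s1, s2, s3]) :
    ∀ S, P S := by
  intro S
  have heq : (![S 0, S 1, S 2, S 3] : Fin 4 → Bool) = S := by ext i; fin_cases i <;> rfl
  rw [← heq]
  exact H _ _ _ _

/-- **An eventually non-increasing sequence of naturals is eventually constant.** [folklore] -/
theorem eventually_constant_of_antitone {f : ℕ → ℕ} {k₀ : ℕ} (hf : ∀ k, k₀ ≤ k → f (k + 1) ≤ f k) :
    ∃ k₁, k₀ ≤ k₁ ∧ ∀ k, k₁ ≤ k → f k = f k₁ := by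
  have hmono : ∀ k₁ k, k₀ ≤ k₁ → k₁ ≤ k → f k ≤ f k₁ := by
    intro k₁ k hk₁ hk
    obtain ⟨n, rfl⟩ := Nat.exists_eq_add_of_le hk
    induction n with
    | zero => simp
    | succ n ih => exact (hf (k₁ + n) (by omega)).trans (ih (by omega))
  -- induction on an upper bound `v` of the value `f k₁`, over all late starting points `k₁`
  suffices key : ∀ v k₁, k₀ ≤ k₁ → f k₁ ≤ v → ∃ k₂, k₁ ≤ k₂ ∧ ∀ k, k₂ ≤ k → f k = f k₂ from key (f k₀) k₀ le_rfl le_rfl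
  intro v
  induction v with
  | zero => exact fun k₁ hk₁ hv => ⟨k₁, le_rfl, fun k hk => by have := hmono k₁ k hk₁ hk; omega⟩
  | succ v ih =>
    intro k₁ hk₁ hv
    by_cases hconst : ∀ k, k₁ ≤ k → f k = f k₁
    · exact ⟨k₁, le_rfl, hconst⟩
    · push Not at hconst
      obtain ⟨k, hk, hne⟩ := hconst
      obtain ⟨k₂, hk₂, h⟩ := ih k (by omega) (by have := hmono k₁ k hk₁ hk; omega)
      exact ⟨k₂, by omega, h⟩

end WeightLedger

open WeightLedger

/-! ## 2. Soundness: the chain's boundary weights walk in the legal ledger -/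

section Chain

variable {K : Type} [Field K] (p : ℕ) [Fact p.Prime] [CharP K p] [DecidableEq K]
  {c : ℕ → State K} {j : ℕ → Fin 4} {b : ℕ → Fin 4 → K}

/-- **THE CHAIN'S WEIGHTS ARE LEGAL LEDGER STATES** (every prime `p`, every shade `d`): along a witnessed isolated above-floor `Step0 p`
chain with `x^{r₀} ∣ F₀` and constant shade `d` from `k₀`, `Legal p d ⇑r_k` for `k ≥ k₀` (floor/pairs: `tail_weights_laws`; ceiling:
`shadeWeights_ceiling`; triples: `IsolatedBand.apply_add_add_le_of_isIsolated`). [OURS · bookkeeping] [cite: CossartJannsenSaito2020, Thm. 3.14] -/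
theorem tail_ledger_legal
    (hc : ∀ k, IsIsolated p (c k).F ∧ Step0 p (c k) (c (k + 1))) (hw : FreeTail.IsWitnessedChain p c j b)
    (hr0 : ∀ e ∈ (c 0).F.support, (c 0).r ≤ e) (hfloor : ∀ k, ordZero (c k).F ≠ p) {k₀ d : ℕ}
    (hshade : ∀ k, k₀ ≤ k → (c k).shade = (d : ℕ∞)) {k : ℕ} (hk : k₀ ≤ k) : Legal p d ⇑(c k).r := by
  obtain ⟨-, -, -, hband, hpair⟩ := tail_weights_laws hc hw hr0 hfloor hshade
  have hceil := shadeWeights_ceiling p hc hw hr0 hfloor hshade hk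
  have hrk := IsolatedBand.isolated_chain_forall_le hc hr0 k
  refine ⟨?_, ?_, fun i i' hii' => hpair k i i' hii', fun i i' i'' h1 h2 h3 => ?_⟩
  · rw [wsum_coe]; exact (hband k hk).1
  · rw [wsum_coe]; exact hceil
  · exact IsolatedBand.apply_add_add_le_of_isIsolated (hc k).1 hrk h1 h2 h3

omit [CharP K p] in
/-- **THE CHAIN STEPS ALONG LEDGER EDGES** (every `p`, every `d`): for `k ≥ k₀`, `⇑r_{k+1}` is the ledger child of `⇑r_k` by the chart `j k`
with kept flags «`b k i = 0`» (the boundary law of `tail_weights_laws` on `Fin 4 → ℕ`). [OURS · bookkeeping] [cite: HauserPerlega2019PRIMS, §2] -/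
theorem tail_ledger_child
    (hc : ∀ k, IsIsolated p (c k).F ∧ Step0 p (c k) (c (k + 1))) (hw : FreeTail.IsWitnessedChain p c j b)
    (hr0 : ∀ e ∈ (c 0).F.support, (c 0).r ≤ e) (hfloor : ∀ k, ordZero (c k).F ≠ p) {k₀ d : ℕ}
    (hshade : ∀ k, k₀ ≤ k → (c k).shade = (d : ℕ∞)) {k : ℕ} (hk : k₀ ≤ k) :
    ⇑(c (k + 1)).r = child p d ⇑(c k).r (j k) (fun i => decide (b k i = 0)) := by
  obtain ⟨-, hlaw, -, -, -⟩ := tail_weights_laws hc hw hr0 hfloor hshade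
  funext i
  rw [hlaw k hk, Finsupp.coe_update, ← wsum_coe]
  by_cases hij : i = j k
  · subst hij
    rw [Function.update_self, child_apply_self]
  · rw [Function.update_of_ne hij, Finsupp.filter_apply, child_apply_of_ne_decide _ hij]

omit [CharP K p] in
/-- **LOSSY STEPS ARE READABLE OFF THE LEDGER**: for `k ≥ k₀`, a boundary letter is translated at step `k` (`b k i ≠ 0`, `1 ≤ r_k i`) iff
`Lossy ⇑r_k ⇑r_{k+1}` (newborn and kept letters weigh `≥ 1`, a translated one `0`). [OURS · bookkeeping] [cite: HauserPerlega2019PRIMS, §2] -/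
theorem tail_lossy_iff
    (hc : ∀ k, IsIsolated p (c k).F ∧ Step0 p (c k) (c (k + 1))) (hw : FreeTail.IsWitnessedChain p c j b)
    (hr0 : ∀ e ∈ (c 0).F.support, (c 0).r ≤ e) (hfloor : ∀ k, ordZero (c k).F ≠ p) {k₀ d : ℕ}
    (hshade : ∀ k, k₀ ≤ k → (c k).shade = (d : ℕ∞)) {k : ℕ} (hk : k₀ ≤ k) :
    (∃ i, b k i ≠ 0 ∧ 1 ≤ (c k).r i) ↔ Lossy ⇑(c k).r ⇑(c (k + 1)).r := by
  obtain ⟨-, -, hbj, hband, -⟩ := tail_weights_laws hc hw hr0 hfloor hshade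
  have hchild := tail_ledger_child p hc hw hr0 hfloor hshade hk
  constructor
  · rintro ⟨i, hbi, hri⟩
    have hij : i ≠ j k := fun h => hbi (h ▸ hbj k)
    refine ⟨i, hri, ?_⟩
    rw [hchild, child_apply_of_ne_decide _ hij, if_neg hbi]
  · rintro ⟨i, hri, hzero⟩
    rw [hchild] at hzero
    by_cases hij : i = j k
    · rw [hij, child_apply_self, wsum_coe] at hzero
      have := (hband k hk).1
      omega
    · rw [child_apply_of_ne_decide _ hij] at hzero
      by_cases hbi : b k i = 0
      · rw [if_pos hbi] at hzero; omega
      · exact ⟨i, hbi, hri⟩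

omit [CharP K p] in
/-- **SATELLITE STEPS ARE READABLE OFF THE LABELLED LEDGER WALK**: for `k ≥ k₀`, `IsSatellite j b k` (`j (k+1) ≠ j k ∧ b (k+1) (j k) = 0`)
iff `j (k+1) ≠ j k` and the letter `j k` still weighs `≠ 0` at `k + 2` (born with weight `|r_k| + d − p ≥ 1`, lost exactly when
translated). [OURS · bookkeeping] [cite: CossartJannsenSaito2020, Thm. 3.14] -/
theorem tail_isSatellite_iff
    (hc : ∀ k, IsIsolated p (c k).F ∧ Step0 p (c k) (c (k + 1))) (hw : FreeTail.IsWitnessedChain p c j b)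
    (hr0 : ∀ e ∈ (c 0).F.support, (c 0).r ≤ e) (hfloor : ∀ k, ordZero (c k).F ≠ p) {k₀ d : ℕ}
    (hshade : ∀ k, k₀ ≤ k → (c k).shade = (d : ℕ∞)) {k : ℕ} (hk : k₀ ≤ k) :
    FreeTail.IsSatellite j b k ↔ (j (k + 1) ≠ j k ∧ (c (k + 2)).r (j k) ≠ 0) := by
  obtain ⟨-, -, -, hband, -⟩ := tail_weights_laws hc hw hr0 hfloor hshade
  have h1 := tail_ledger_child p hc hw hr0 hfloor hshade hk
  have h2 := tail_ledger_child p hc hw hr0 hfloor hshade (k := k + 1) (by omega)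
  have hnew : (c (k + 1)).r (j k) = (c k).r.degree + d - p := by
    have := congrFun h1 (j k)
    rw [child_apply_self, wsum_coe] at this
    exact this
  have hpos : 1 ≤ (c (k + 1)).r (j k) := by rw [hnew]; have := (hband k hk).1; omega
  unfold FreeTail.IsSatellite
  refine and_congr_right fun hjj => ?_
  have h2' : (c (k + 2)).r (j k) = if b (k + 1) (j k) = 0 then (c (k + 1)).r (j k) else 0 := by
    have := congrFun h2 (j k)
    rw [child_apply_of_ne_decide _ (Ne.symm hjj)] at this
    exact this
  rw [h2']
  by_cases hb : b (k + 1) (j k) = 0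
  · rw [if_pos hb]
    exact ⟨fun _ => by omega, fun _ => hb⟩
  · rw [if_neg hb]
    exact ⟨fun h => absurd h hb, fun h => absurd rfl h⟩

omit [CharP K p] in
/-- The same in FT's letter convention (`no_tail_of_eventually_free`: «NOT a satellite at `k`» = `j (k+1) = j k ∨ b (k+1) (j k) ≠ 0`):
for `k ≥ k₀`, `¬ IsSatellite j b k ↔ (j (k+1) = j k ∨ r_{k+2} (j k) = 0)`. [OURS · bookkeeping] -/
theorem tail_not_isSatellite_iff
    (hc : ∀ k, IsIsolated p (c k).F ∧ Step0 p (c k) (c (k + 1))) (hw : FreeTail.IsWitnessedChain p c j b)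
    (hr0 : ∀ e ∈ (c 0).F.support, (c 0).r ≤ e) (hfloor : ∀ k, ordZero (c k).F ≠ p) {k₀ d : ℕ}
    (hshade : ∀ k, k₀ ≤ k → (c k).shade = (d : ℕ∞)) {k : ℕ} (hk : k₀ ≤ k) :
    ¬ FreeTail.IsSatellite j b k ↔ (j (k + 1) = j k ∨ (c (k + 2)).r (j k) = 0) := by
  rw [tail_isSatellite_iff p hc hw hr0 hfloor hshade hk, not_and_or, not_ne_iff, not_ne_iff]

/-! ## 3. The three fairness laws of a tail, in ledger words -/

/-- **THE DOCK IN LEDGER WORDS**: beyond every index the tail visits a LOWER-BAND state `|r_k| + d < 3p/2` (`no_tail_of_lower_band_budget`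
with budget `0`). [OURS] [cite: CossartJannsenSaito2020, Thm. 3.14] -/
theorem exists_lowerBand_after
    (hc : ∀ k, IsIsolated p (c k).F ∧ Step0 p (c k) (c (k + 1))) (hw : FreeTail.IsWitnessedChain p c j b)
    (hr0 : ∀ e ∈ (c 0).F.support, (c 0).r ≤ e) (hfloor : ∀ k, ordZero (c k).F ≠ p) {k₀ d : ℕ}
    (hshade : ∀ k, k₀ ≤ k → (c k).shade = (d : ℕ∞)) {k₂ : ℕ} (hk₂ : k₀ ≤ k₂) :
    ∃ k, k₂ ≤ k ∧ LowerBand p d ⇑(c k).r := by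
  classical
  by_contra hno
  push Not at hno
  refine no_tail_of_lower_band_budget p hc hw hr0 hfloor hshade hk₂ (B := 0) fun n => ?_
  rw [Nat.le_zero, Finset.card_eq_zero, Finset.filter_eq_empty_iff]
  intro i _ hlt
  have h := hno (k₂ + i) (by omega)
  rw [← wsum_coe] at hlt
  omega

/-- **FT IN LEDGER WORDS**: beyond every index there is a SATELLITE step (`no_tail_of_eventually_free`; no shade or `e_G` hypothesis).
[OURS] [cite: CossartJannsenSaito2020, Thm. 3.14] -/
theorem exists_satellite_after
    (hc : ∀ k, IsIsolated p (c k).F ∧ Step0 p (c k) (c (k + 1))) (hw : FreeTail.IsWitnessedChain p c j b) (k₂ : ℕ) :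
    ∃ k, k₂ ≤ k ∧ FreeTail.IsSatellite j b k := by
  by_contra hno
  push Not at hno
  refine no_tail_of_eventually_free p hc hw (k₁ := k₂) fun k hk => ?_
  have h := hno k hk
  unfold FreeTail.IsSatellite at h
  by_cases hjj : j (k + 1) = j k
  · exact Or.inl hjj
  · exact Or.inr fun hb => h ⟨hjj, hb⟩

/-- **C13 IN LEDGER WORDS** (`d < p`, `e_G ≡ 2`): beyond every index there is a LOSSY ledger edge (`no_lossfree_tail`). [OURS]
[cite: CossartJannsenSaito2020, Thm. 3.10(4), Thm. 3.14, Thm. 9.3] -/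
theorem exists_lossy_after
    (hc : ∀ k, IsIsolated p (c k).F ∧ Step0 p (c k) (c (k + 1))) (hw : FreeTail.IsWitnessedChain p c j b)
    (hr0 : ∀ e ∈ (c 0).F.support, (c 0).r ≤ e) (hfloor : ∀ k, ordZero (c k).F ≠ p) {k₀ d : ℕ} (hdp : d < p)
    (hshade : ∀ k, k₀ ≤ k → (c k).shade = (d : ℕ∞)) (he : ∀ k, k₀ ≤ k → Module.finrank K (resVertex (c k)) = 2)
    {k₂ : ℕ} (hk₂ : k₀ ≤ k₂) : ∃ k, k₂ ≤ k ∧ Lossy ⇑(c k).r ⇑(c (k + 1)).r := by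
  by_contra hno'
  have hno : ∀ k, k₂ ≤ k → ¬ Lossy ⇑(c k).r ⇑(c (k + 1)).r := fun k hk hl => hno' ⟨k, hk, hl⟩
  refine no_lossfree_tail p hc hw hr0 hfloor hdp (k₀ := k₂) (fun k hk => hshade k (by omega))
    (fun k hk => he k (by omega)) fun k hk i hbi => ?_
  by_contra hri
  exact hno k hk ((tail_lossy_iff p hc hw hr0 hfloor hshade (k := k) (by omega)).mp ⟨i, hbi, by omega⟩)

/-! ## 4. Potentials: the certificate socket -/

/-- **A LEDGER POTENTIAL IS EVENTUALLY CONSTANT ALONG A TAIL** (every prime `p`, every shade `d`): if `h : (Fin 4 → ℕ) → ℕ` does not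
increase along any legal ledger edge, then on a constant-shade-`d` tail `h ⇑r_k` is constant from some `k₁ ≥ k₀` on — the tail is CONFINED
to one level set of `h` (with `h` the reverse-topological SCC index: to one strongly connected component). [OURS] [folklore] -/
theorem ledger_potential_eventually_constant
    (hc : ∀ k, IsIsolated p (c k).F ∧ Step0 p (c k) (c (k + 1))) (hw : FreeTail.IsWitnessedChain p c j b)
    (hr0 : ∀ e ∈ (c 0).F.support, (c 0).r ≤ e) (hfloor : ∀ k, ordZero (c k).F ≠ p) {k₀ d : ℕ}
    (hshade : ∀ k, k₀ ≤ k → (c k).shade = (d : ℕ∞)) (h : (Fin 4 → ℕ) → ℕ)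
    (hmono : ∀ a (jj : Fin 4) (S : Fin 4 → Bool), Legal p d a → Legal p d (child p d a jj S) → h (child p d a jj S) ≤ h a) :
    ∃ i k₁, k₀ ≤ k₁ ∧ ∀ k, k₁ ≤ k → h ⇑(c k).r = i := by
  have hstep : ∀ k, k₀ ≤ k → h ⇑(c (k + 1)).r ≤ h ⇑(c k).r := by
    intro k hk
    have hl := tail_ledger_legal p hc hw hr0 hfloor hshade hk
    have hl' := tail_ledger_legal p hc hw hr0 hfloor hshade (k := k + 1) (by omega)
    rw [tail_ledger_child p hc hw hr0 hfloor hshade hk] at hl' ⊢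
    exact hmono _ _ _ hl hl'
  obtain ⟨k₁, hk₁, hconst⟩ := eventually_constant_of_antitone (f := fun k => h ⇑(c k).r) hstep
  exact ⟨h ⇑(c k₁).r, k₁, hk₁, hconst⟩

/-- **PRUNE (a) — A LEVEL OFF THE LOWER BAND CARRIES NO TAIL**: if the tail is confined to the level `i` of `h` from `k₁ ≥ k₀` and no legal
state of level `i` is lower-band, contradiction with the dock. [OURS] [cite: CossartJannsenSaito2020, Thm. 3.14] -/
theorem no_tail_of_level_off_lowerBand
    (hc : ∀ k, IsIsolated p (c k).F ∧ Step0 p (c k) (c (k + 1))) (hw : FreeTail.IsWitnessedChain p c j b)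
    (hr0 : ∀ e ∈ (c 0).F.support, (c 0).r ≤ e) (hfloor : ∀ k, ordZero (c k).F ≠ p) {k₀ d : ℕ}
    (hshade : ∀ k, k₀ ≤ k → (c k).shade = (d : ℕ∞)) {h : (Fin 4 → ℕ) → ℕ} {i k₁ : ℕ} (hk₁ : k₀ ≤ k₁)
    (hlev : ∀ k, k₁ ≤ k → h ⇑(c k).r = i) (hdock : ∀ a, Legal p d a → h a = i → ¬ LowerBand p d a) : False := by
  obtain ⟨k, hk, hlow⟩ := exists_lowerBand_after p hc hw hr0 hfloor hshade hk₁
  exact hdock _ (tail_ledger_legal p hc hw hr0 hfloor hshade (by omega)) (hlev k hk) hlow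

/-- **PRUNE (b) — A SATELLITE-FREE LEVEL CARRIES NO TAIL**: if the tail is confined to the level `i` of `h` from `k₁ ≥ k₀` and level `i` has
no legal 2-path `a →_j b →_{j′} c` with `j′ ≠ j`, `c j ≠ 0` (a satellite pattern), contradiction with FT. [OURS] [cite: CossartJannsenSaito2020, Thm. 3.14] -/
theorem no_tail_of_level_satelliteFree
    (hc : ∀ k, IsIsolated p (c k).F ∧ Step0 p (c k) (c (k + 1))) (hw : FreeTail.IsWitnessedChain p c j b)
    (hr0 : ∀ e ∈ (c 0).F.support, (c 0).r ≤ e) (hfloor : ∀ k, ordZero (c k).F ≠ p) {k₀ d : ℕ}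
    (hshade : ∀ k, k₀ ≤ k → (c k).shade = (d : ℕ∞)) {h : (Fin 4 → ℕ) → ℕ} {i k₁ : ℕ} (hk₁ : k₀ ≤ k₁)
    (hlev : ∀ k, k₁ ≤ k → h ⇑(c k).r = i)
    (hFT : ∀ a (jj : Fin 4) (S : Fin 4 → Bool) (jj' : Fin 4) (S' : Fin 4 → Bool),
      Legal p d a → Legal p d (child p d a jj S) → Legal p d (child p d (child p d a jj S) jj' S') →
      h a = i → h (child p d a jj S) = i → h (child p d (child p d a jj S) jj' S') = i → jj' ≠ jj →
      child p d (child p d a jj S) jj' S' jj = 0) : False := by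
  obtain ⟨k, hk, hsat⟩ := exists_satellite_after p hc hw k₁
  obtain ⟨hjj, hne⟩ := (tail_isSatellite_iff p hc hw hr0 hfloor hshade (k := k) (by omega)).mp hsat
  have hl0 := tail_ledger_legal p hc hw hr0 hfloor hshade (k := k) (by omega)
  have hl1 := tail_ledger_legal p hc hw hr0 hfloor hshade (k := k + 1) (by omega)
  have hl2 := tail_ledger_legal p hc hw hr0 hfloor hshade (k := k + 2) (by omega)
  have hh0 := hlev k hk; have hh1 := hlev (k + 1) (by omega); have hh2 := hlev (k + 2) (by omega)
  rw [tail_ledger_child p hc hw hr0 hfloor hshade (k := k + 1) (by omega),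
    tail_ledger_child p hc hw hr0 hfloor hshade (k := k) (by omega)] at hl2 hh2 hne
  rw [tail_ledger_child p hc hw hr0 hfloor hshade (k := k) (by omega)] at hl1 hh1
  exact hne (hFT _ _ _ _ _ hl0 hl1 hl2 hh0 hh1 hh2 hjj)

/-- **PRUNE (c) — A LOSS-FREE LEVEL CARRIES NO BINARY-CONE TAIL** (`d < p`, `e_G ≡ 2`): if the tail is confined to the level `i` of `h` from
`k₁ ≥ k₀` and no legal edge inside level `i` is lossy, contradiction with C13. [OURS] [cite: CossartJannsenSaito2020, Thm. 3.10(4), Thm. 9.3] -/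
theorem no_tail_of_level_lossfree
    (hc : ∀ k, IsIsolated p (c k).F ∧ Step0 p (c k) (c (k + 1))) (hw : FreeTail.IsWitnessedChain p c j b)
    (hr0 : ∀ e ∈ (c 0).F.support, (c 0).r ≤ e) (hfloor : ∀ k, ordZero (c k).F ≠ p) {k₀ d : ℕ} (hdp : d < p)
    (hshade : ∀ k, k₀ ≤ k → (c k).shade = (d : ℕ∞)) (he : ∀ k, k₀ ≤ k → Module.finrank K (resVertex (c k)) = 2)
    {h : (Fin 4 → ℕ) → ℕ} {i k₁ : ℕ} (hk₁ : k₀ ≤ k₁) (hlev : ∀ k, k₁ ≤ k → h ⇑(c k).r = i)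
    (hC13 : ∀ a (jj : Fin 4) (S : Fin 4 → Bool), Legal p d a → Legal p d (child p d a jj S) →
      h a = i → h (child p d a jj S) = i → ¬ Lossy a (child p d a jj S)) : False := by
  obtain ⟨k, hk, hlossy⟩ := exists_lossy_after p hc hw hr0 hfloor hdp hshade he hk₁
  have hl0 := tail_ledger_legal p hc hw hr0 hfloor hshade (k := k) (by omega)
  have hl1 := tail_ledger_legal p hc hw hr0 hfloor hshade (k := k + 1) (by omega)
  have hh0 := hlev k hk
  have hh1 := hlev (k + 1) (by omega)
  have hc1 := tail_ledger_child p hc hw hr0 hfloor hshade (k := k) (by omega)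
  rw [hc1] at hl1 hh1 hlossy
  exact hC13 _ _ _ hl0 hl1 hh0 hh1 hlossy

end Chain

end ResCone

end Summit.ResolutionOfSingularities.ResolutionOfSingularities.Theorems.PIDim4

end
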